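import Summits.HodgeConjecture.HodgeConjecture.Theses.LinearSystemTorelli
import Literature.AlgebraicGeometry.HodgeTheory.CorrespondenceAction

/-!
# Crux-ideate sketch (round 2, ideator 5) — idea `ch0-null-correspondence-support`
("reverse Bloch–Srinivas"): the typed LANDING PAD of the lever and its composition to the crux
`LinearSystemTorelli.MiddleDivisorSupport` BY NAME.

The lever: if an algebraic self-correspondence `Z` of `X^{2p}` FIXES the middle Hodge class `c`
(`[Z]^* c = c`) and is (rationally equivalent to a cycle) supported in `T × X` with `T` Zariski
closed of codimension `≥ 1` — which is what the Bloch–Srinivas lemma (Voisin II Thm 10.19 /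
Cor 10.20; tree fact shape `Motives.BlochSrinivas1983_principle_flatFamily`) outputs from the
CH₀-nullity of `Z` — then `c` is supported on the divisor `T` (Voisin II (10.8); tree:
`CorrespondenceAction.act_mem_supportedClasses`). Scratch only; NOT a skeleton.
-/

namespace Summit.HodgeConjecture.HodgeConjecture.Cruxes.MiddleDivisorSupport.ReverseBlochSrinivas

open CategoryTheory AlgebraicGeometry MonoidalCategory
open Literature.AlgebraicGeometry Literature.AlgebraicGeometry.HodgeTheory
open Literature.AlgebraicGeometry.Motives

/-- LANDING PAD `FixedByDivisorSupportedCorrespondence` (= HP ∧ GB₀ after Bloch–Srinivas): for every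
smooth projective `X` of dimension `2p` (`p ≥ 1`) and every rational class `c ∈ H^{2p}(X(ℂ);ℂ)` of
Hodge type `(p,p)`, there are a correspondence action `Γ` (hypothesis structure, intended instance
Voisin II (10.7)), a `2p`-cycle `Z` on `X × X` supported in `T × X` for a Zariski-closed `T ⊆ X` of
codimension `≥ 1`, with `[Z]^* c = c`. -/
def FixedByDivisorSupportedCorrespondence : Prop :=
  ∀ ⦃p : ℕ⦄ ⦃X : SchemeOver ℂ⦄, 1 ≤ p → IsSmoothProjective (2 * p) X →
    ∀ c : complexBetti X (2 * p), IsRationalClass c → IsOfHodgeType (2 * p) X (2 * p) p p c →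
      ∃ (Γ : CorrespondenceAction (2 * p) X) (Z : ↥(cyclesOfDim (X ⊗ X).left (2 * p)))
        (T : Set X.left), IsClosed T ∧ (∀ z ∈ T, (1 : ℕ∞) ≤ Order.coheight z) ∧
        (∀ z, (Z : AlgebraicCycle (X ⊗ X).left ℤ) z ≠ 0 →
          (CartesianMonoidalCategory.fst X X).left.base z ∈ T) ∧
        Γ.act (2 * p) Z c = c

/-- pad → crux BY NAME (three lines over `CorrespondenceAction.act_mem_supportedClasses`). -/
theorem middleDivisorSupport_of_fixedByDivisorSupportedCorrespondence
    (h : FixedByDivisorSupportedCorrespondence) :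
    Summit.HodgeConjecture.HodgeConjecture.Theses.LinearSystemTorelli.MiddleDivisorSupport := by
  intro p X hp hX c hc hh
  obtain ⟨Γ, Z, T, hT, hcodim, hZ, hfix⟩ := h hp hX c hc hh
  rw [← hfix]
  exact Γ.act_mem_supportedClasses (2 * p) hT hcodim hZ c

/-- HP, the HOMOLOGICAL half of the split ("Hodge-isolating correspondence"): some `2p`-cycle `Z`
on `X × X` acts as the identity on `c` and kills every class of type `(q,0)`, `q ≥ 1` (typed with
the same hypothesis-structure action; the intended instance is the cycle-class action). Theorem on
CM / Weil-type abelian varieties (K-eigenprojectors are ℚ-combinations of endomorphism graphs);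
open in general; implied by HC for `X × X`. -/
def HodgeIsolatingCorrespondence : Prop :=
  ∀ ⦃p : ℕ⦄ ⦃X : SchemeOver ℂ⦄, 1 ≤ p → IsSmoothProjective (2 * p) X →
    ∀ (Γ : CorrespondenceAction (2 * p) X) (c : complexBetti X (2 * p)),
      IsRationalClass c → IsOfHodgeType (2 * p) X (2 * p) p p c →
      ∃ Z : ↥(cyclesOfDim (X ⊗ X).left (2 * p)),
        Γ.act (2 * p) Z c = c ∧
        ∀ (q : ℕ), 1 ≤ q → ∀ η : complexBetti X q, IsOfHodgeType (2 * p) X q q 0 η →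
          Γ.act q Z η = 0

end Summit.HodgeConjecture.HodgeConjecture.Cruxes.MiddleDivisorSupport.ReverseBlochSrinivas
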